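import Literature.NumberTheory.Automorphic.Liu2021.AppendixC.OmegaHomIsotypicMultOne
import Literature.NumberTheory.Automorphic.Liu2021.AppendixC.OmegaHomIsotypicComponentLevelwise
import HarnessLib

/-!
# [Liu 2021, p. 133 (D.3) / Prop. D.4 (1)] multiplicity one ⇒ the isotypic component of `[·]_K⁻¹ f′(ω^K)` is itself — LEVELWISE edition

Topic `NumberTheory/Automorphic/Liu2021/AppendixC`; namespace `Literature.NumberTheory.Automorphic.Liu2021.AppendixC.Sec42Data.HeckeTranslates`.
THEOREMS ONLY (no definition, no named fact, no instance, no `sorry`).  Edition of ★ `OmegaHomIsotypicMultOne.isotypicComponent_eq_of_forall_eq_smul`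
with the global semisimplicity instance `[σ.IsSemisimpleRepresentation]` (an S1c-strength input) replaced by the LEVELWISE family
`hssM : ∀ K′, ℚ̄_ℓ ⊗ H¹_ét(A_{K′})` is a semisimple module over the realised Hecke algebra (the (O-III) currency of ★
`OmegaHomIsotypicComponentLevelwise`); `σ = 1 ⊗ rhoEt` and `hσ` stay as plain binders (they only feed ★ `range_toTower_baseChange_eq_fixedPoints`,
which uses no semisimplicity).  Written for the σ-free (MO) producer of the d6 card (A-p07 (g12) `OmegaHomBlockCharacters.mem_omegaBlock_of_forall_eigen`,
with A-p05 (g12)).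

* **`isotypicComponent_eq_of_forall_eq_smul_of_levelwise`** — under `∀ f ∈ X.omegaHom ι ρW, ∃ c, f = c • f′` and `hssM`:
  `isotypicComponent 𝒜 M S = N₀` for every `𝒜`-module `S ≃ N₀`.

Count-neutral (`--supports` stmt-HodgeConjecture-24832); HC_CM is proved only modulo the 7 printed citations until rung 0 closes.

## References
* [Liu2021] Y. Liu, *Fourier–Jacobi cycles and arithmetic relative trace formula*, Camb. J. Math. 9 (2021), p. 133 (D.3), Prop. D.4 (1) (p. 130),
  p. 140 (FJcycle.tex l. 5626), §4.2 (l. 2158–2166).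
* [Bump1997] D. Bump, *Automorphic Forms and Representations* (1997), Prop. 4.2.3 (p. 427).
-/

set_option autoImplicit false

noncomputable section

open CategoryTheory NumberField Function MulAction
open scoped TensorProduct

namespace Literature.NumberTheory.Automorphic.Liu2021.AppendixC

open Literature.AlgebraicGeometry.Motives (AbelianVariety)
open Literature.AlgebraicGeometry.Motives.AbelianVariety (rationalTateModuleMap endAlgebra rationalTateAction)

variable {F E : Type} [Field F] [NumberField F] [IsTotallyReal F] [Field E] [NumberField E] [Algebra F E]
  [IsTotallyComplex E] [Algebra.IsQuadraticExtension F E]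
variable {P5 : PropC5Data F E} {isotropicAt : ℕ → Prop}

namespace Sec42Data.HeckeTranslates

variable {C : Sec42Data P5 isotropicAt} (T : C.HeckeTranslates) {ℓ : ℕ} [Fact ℓ.Prime]
variable (K : C5.SmallLevel C.S.K₀)
  (hI : ∀ ⦃K K' : C5.SmallLevel C.S.K₀⦄ (f : K' ⟶ K), Function.Injective (rationalTateModuleMap ℓ (C.Atr f)).dualMap)
  (X : C.EtaleHeckeDatum ℓ) (hX : X.rhoEt = T.etHeckeRep ℓ) (ι : ℂ ≃+* AlgebraicClosure ℚ_[ℓ])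
  {W : Type} [AddCommGroup W] [Module ℂ W] (ρW : Representation ℂ C.G W)
  {f : W →ₛₗ[(ι : ℂ →+* AlgebraicClosure ℚ_[ℓ])] AlgebraicClosure ℚ_[ℓ] ⊗[ℚ_[ℓ]] C.etaleH1Tower ℓ} (hf : f ∈ X.omegaHom ι ρW)
  (σ : Representation (AlgebraicClosure ℚ_[ℓ]) C.G (AlgebraicClosure ℚ_[ℓ] ⊗[ℚ_[ℓ]] C.etaleH1Tower ℓ))
  (hσ : ∀ g : C.G, σ g = (X.rhoEt g).baseChange (AlgebraicClosure ℚ_[ℓ]))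

include hI hX hf hσ in
/-- **MULTIPLICITY ONE ⇒ THE ISOTYPIC COMPONENT OF `N₀ = [·]_K⁻¹ f′(ω^K)` IS `N₀` — levelwise edition** ([Liu2021] (D.3) with Prop. D.4 (1):
the `(π^∞)^K`-isotypic part of `H¹(A_K)` is one copy of `(π^∞)^K`).  With `𝒜`, `N₀`, `hN₀`, `σ` as in ★ `OmegaHomIsotypicComponent` and the
levelwise semisimplicity family `hssM` in place of `[σ.IsSemisimpleRepresentation]`: if every element of `X.omegaHom ι ρW` is a multiple of `f′`
and `f′ ≠ 0` on `ω^K`, then for every `𝒜`-module `S ≃ N₀`, `isotypicComponent 𝒜 (ℚ̄_ℓ ⊗ H¹_ét(A_K)) S = N₀`.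
[cite: Liu2021, p. 133 (D.3) and Prop. D.4 (1) (p. 130)] [cite: Bump1997, Prop. 4.2.3] -/
theorem isotypicComponent_eq_of_forall_eq_smul_of_levelwise (hD : T.IsogenyDescent) [ρW.IsIrreducible]
    (hssM : ∀ K' : C5.SmallLevel C.S.K₀,
      IsSemisimpleModule ↥(Algebra.adjoin (AlgebraicClosure ℚ_[ℓ])
        ((Set.range fun g : C.G => ((rationalTateAction (C.A K') ℓ (T.heckeEnd hD K' g)).dualMap).baseChange (AlgebraicClosure ℚ_[ℓ])) :
          Set (Module.End (AlgebraicClosure ℚ_[ℓ]) (AlgebraicClosure ℚ_[ℓ] ⊗[ℚ_[ℓ]] C.etaleH1 ℓ K'))))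
        (AlgebraicClosure ℚ_[ℓ] ⊗[ℚ_[ℓ]] C.etaleH1 ℓ K'))
    (𝒜 : Subalgebra (AlgebraicClosure ℚ_[ℓ]) (Module.End (AlgebraicClosure ℚ_[ℓ]) (AlgebraicClosure ℚ_[ℓ] ⊗[ℚ_[ℓ]] C.etaleH1 ℓ K)))
    (h𝒜 : ∀ g : C.G, ((rationalTateAction (C.A K) ℓ (T.heckeEnd hD K g)).dualMap).baseChange (AlgebraicClosure ℚ_[ℓ]) ∈ 𝒜)
    (N₀ : Submodule ↥𝒜 (AlgebraicClosure ℚ_[ℓ] ⊗[ℚ_[ℓ]] C.etaleH1 ℓ K))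
    (hN₀ : N₀.restrictScalars (AlgebraicClosure ℚ_[ℓ]) =
      ((ρW.fixedPoints (K.1.1 : Subgroup C.G)).map f).comap ((C.toTower ℓ K).baseChange (AlgebraicClosure ℚ_[ℓ])))
    (hf0 : ∃ w ∈ ρW.fixedPoints (K.1.1 : Subgroup C.G), f w ≠ 0)
    (hm1 : ∀ f₁ ∈ X.omegaHom ι ρW, ∃ c : AlgebraicClosure ℚ_[ℓ], f₁ = c • f)
    (S : Type*) [AddCommGroup S] [Module ↥𝒜 S] (eS : S ≃ₗ[↥𝒜] ↥N₀) :
    isotypicComponent ↥𝒜 (AlgebraicClosure ℚ_[ℓ] ⊗[ℚ_[ℓ]] C.etaleH1 ℓ K) S = N₀ := by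
  have hσ' : ∀ g : C.G, σ g = (T.etHeckeRep ℓ g).baseChange (AlgebraicClosure ℚ_[ℓ]) := fun g => by rw [hσ, hX]
  have hjK : LinearMap.range ((C.toTower ℓ K).baseChange (AlgebraicClosure ℚ_[ℓ])) = σ.fixedPoints (K.1.1 : Subgroup C.G) :=
    T.range_toTower_baseChange_eq_fixedPoints ℓ K hI σ hσ' hD
  have hker : LinearMap.ker f = ⊥ := by
    obtain ⟨w, -, hw⟩ := hf0
    exact ker_eq_bot_of_mem_omegaHom X ι ρW hf ⟨w, hw⟩
  refine le_antisymm ?_ ?_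
  · intro y hy
    have hspan : Submodule.span (AlgebraicClosure ℚ_[ℓ]) {y | ∃ f₁ ∈ X.omegaHom ι ρW, ∃ w : W, f₁ w = y} ≤ LinearMap.range f := by
      refine Submodule.span_le.2 ?_
      rintro _ ⟨f₁, hf₁, w, rfl⟩
      obtain ⟨c, rfl⟩ := hm1 f₁ hf₁
      refine ⟨ι.symm c • w, ?_⟩
      rw [LinearMap.map_smulₛₗ, LinearMap.smul_apply]
      congr 1
      exact ι.apply_symm_apply c
    have hjy := T.map_isotypicComponent_le_span_blockValues_of_levelwise K hI X hX ι ρW hf σ hσ hD hssM 𝒜 h𝒜 N₀ hN₀ S eS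
      ⟨y, hy, rfl⟩
    have hrange : (C.toTower ℓ K).baseChange (AlgebraicClosure ℚ_[ℓ]) y ∈ LinearMap.range f := hspan hjy
    have hfix : ∀ k ∈ (K.1.1 : Subgroup C.G),
        (X.rhoEt k).baseChange (AlgebraicClosure ℚ_[ℓ]) ((C.toTower ℓ K).baseChange (AlgebraicClosure ℚ_[ℓ]) y) =
          (C.toTower ℓ K).baseChange (AlgebraicClosure ℚ_[ℓ]) y := by
      intro k hk
      have : (C.toTower ℓ K).baseChange (AlgebraicClosure ℚ_[ℓ]) y ∈ σ.fixedPoints (K.1.1 : Subgroup C.G) := by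
        rw [← hjK]
        exact ⟨y, rfl⟩
      rw [Representation.mem_fixedPoints] at this
      rw [← hσ]
      exact this k hk
    have hmem := mem_map_fixedPoints_of_mem_range K X ι ρW hf hker hrange hfix
    have : y ∈ N₀.restrictScalars (AlgebraicClosure ℚ_[ℓ]) := by
      rw [hN₀, Submodule.mem_comap]
      exact hmem
    exact this
  · exact le_sSup ⟨eS.symm⟩

end Sec42Data.HeckeTranslates

end Literature.NumberTheory.Automorphic.Liu2021.AppendixC
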